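import Mathlib
import HarnessLib
import Literature.MathematicalPhysics.QuantumLattice.GrassmannKernelExpansion
import Summits.HubbardSuperconductivity.HubbardSuperconductivity.Theorems.KLProgrammeKLRegimeSplitPredicatesV3

/-!
# Route `KLProgramme`, crux K3 (stmt-HubbardSuperconductivity-19937), child 1 `KLRegimeBetaSplit` — ANTISYMMETRY of the Grassmann
# kernels under permutation of the legs, and the identification of the `↑↓` running coupling VALUE with the pair array entry

Cell gate-hubbard-kl, seat p1b (g3).  Text: HOME/STATUS p1b 2026-08-26T12:5xZ (Δ11 (spin)); HOME/prover-p1b/GAINS-NOTE.md §6.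

Child 1's value line at pair-class kinematics is supplied by (B1-v2) `PairArrayAt` (an `↑↓` pair-array statement) through the
identity «`klQuarticValue … n 0 1 k₁ k₂ k₃` is an EVEN leg permutation of `klPairAmplitude … n (k₁+k₃) k₂ k₁`» (p1's supplier table,
`KLProgrammeKLRegimeSplitPredicatesV3`).  This file proves the two generic facts behind it and the identity itself:

* `klka_kernel_comp_perm` — the kernels `kernel R F m` of ANY element of a Grassmann algebra are antisymmetric:
  `kernel R F m (X ∘ τ) = sign τ · kernel R F m X` (basis monomials: `kernel (genProd Y) m X ∝ det[δ_{X_i,Y_j}]` and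
  `Matrix.det_permute`; general `F` by the span of the monomial basis);
* `klka_vertexFn_comp_perm` — the same for Salmhofer's vertex functions `vertexFn = m!(βL²)^{m-1}·kernel`;
* `klka_quarticValue_eq_pairAmplitude` — `klQuarticValue L M β U μ K n 0 1 k₁ k₂ k₃ = klPairAmplitude L M β U μ K n (k₁ + k₃) k₂ k₁`
  (the 3-cycle `(1 2 3)` on the four field labels, sign `+1`), and `klka_quarticValueLine_of_pairArray`: a pair-array bound
  `∀ Q ∃ u, |u| ≤ B₁ ∧ ∀ k k', |𝒞_n(Q;k,k') − u| ≤ B₂` on the ball gives `|λ_n^{↑↓}(k₁,k₂,k₃)| ≤ B₁ + B₂` for ball momenta — the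
  value line's pair-class AND frozen cases at once ((B1-v2) quantifies over EVERY total momentum).

Nothing is asserted about the model beyond these algebraic identities.
-/

noncomputable section

namespace Summit.HubbardSuperconductivity.HubbardSuperconductivity.Theorems.KLRegimeSplit

set_option linter.dupNamespace false -- summit = problem name (single-conjunct summit), D-0017

open Finset Literature.MathematicalPhysics.QuantumLattice Literature.Probability.LatticeModels
open Literature.MathematicalPhysics.QuantumLattice.GrassmannAlgebra
open Summit.HubbardSuperconductivity.HubbardSuperconductivity.Theorems.KLProgrammeLegKernels

/-! ## §1 Kernels are antisymmetric under permutation of the legs -/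

section Kernel

variable (R : Type*) [CommRing R] [Algebra ℚ R] {Γ : Type*} [Fintype Γ] [DecidableEq Γ]

omit [Algebra ℚ R] [Fintype Γ] in
/-- The delta matrix of a permuted label tuple is the row-permuted delta matrix. -/
theorem klka_deltaMatrix_comp_perm {m : ℕ} (X Y : Fin m → Γ) (τ : Equiv.Perm (Fin m)) :
    deltaMatrix R (X ∘ τ) Y = (deltaMatrix R X Y).submatrix τ id := by
  ext i j
  simp [deltaMatrix_apply]

omit [Fintype Γ] in
/-- Antisymmetry of the kernels of a product of generators. -/
theorem klka_kernel_genProd_comp_perm {m k : ℕ} (Y : Fin k → Γ) (X : Fin m → Γ) (τ : Equiv.Perm (Fin m)) :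
    kernel R (genProd R Y) m (X ∘ τ) = (Equiv.Perm.sign τ : R) * kernel R (genProd R Y) m X := by
  by_cases h : m = k
  · subst h
    rw [kernel_genProd, kernel_genProd, klka_deltaMatrix_comp_perm, Matrix.det_permute]
    ring
  · rw [kernel_genProd_of_ne R _ Y h, kernel_genProd_of_ne R _ Y h, mul_zero]

/-- **The kernels of every element of a Grassmann algebra are antisymmetric under permutation of the legs**:
`kernel R F m (X ∘ τ) = sign τ · kernel R F m X`. -/
theorem klka_kernel_comp_perm (F : GrassmannAlgebra R Γ) {m : ℕ} (X : Fin m → Γ) (τ : Equiv.Perm (Fin m)) :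
    kernel R F m (X ∘ τ) = (Equiv.Perm.sign τ : R) * kernel R F m X := by
  letI : LinearOrder Γ := LinearOrder.lift' (Fintype.equivFin Γ) (Fintype.equivFin Γ).injective
  have hF := (grassmannBasis R Γ).mem_span F
  induction hF using Submodule.span_induction with
  | mem x hx =>
    obtain ⟨s, rfl⟩ := hx
    rw [grassmannBasis_eq_genProd' R s]
    exact klka_kernel_genProd_comp_perm R _ X τ
  | zero => simp
  | add x y _ _ hx hy => rw [kernel_add, kernel_add, hx, hy, mul_add]
  | smul r x _ hx => rw [kernel_smul, kernel_smul, hx]; ring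

end Kernel

/-! ## §2 Vertex functions; the `↑↓` running coupling value IS a pair-array entry -/

section Model

variable (L M : ℕ) [NeZero L] [NeZero M]

omit [NeZero M] in
/-- Antisymmetry of Salmhofer's vertex functions under permutation of the legs. -/
theorem klka_vertexFn_comp_perm (β : ℝ) (G : HubbardGrassmann L M) {m : ℕ} (X : Fin m → HubbardFieldIdx L M)
    (τ : Equiv.Perm (Fin m)) :
    vertexFn L M β G m (X ∘ τ) = (Equiv.Perm.sign τ : ℂ) * vertexFn L M β G m X := by
  rw [vertexFn_def, vertexFn_def, klka_kernel_comp_perm]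
  ring

omit [NeZero L] [NeZero M] in
/-- The 3-cycle `swap 1 2 * swap 2 3` on `Fin 4` (sending the label order of `klQuarticValue` to that of `klPairAmplitude`) is even. -/
theorem klka_sign_cycle : Equiv.Perm.sign (Equiv.swap (1 : Fin 4) 2 * Equiv.swap (2 : Fin 4) 3) = 1 := by
  decide

/-- **The `↑↓` running coupling value is a pair-array entry**:
`klQuarticValue … n 0 1 k₁ k₂ k₃ = klPairAmplitude … n (k₁ + k₃) k₂ k₁` (labels `(ω₀k₁↑+),(ω₀k₂↑−),(−ω₀k₃↓+),(−ω₀k₄↓−)`,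
`k₄ = k₁ − k₂ + k₃`, versus `(ω₀k₁↑+),(−ω₀k₃↓+),(−ω₀k₄↓−),(ω₀k₂↑−)`: an even permutation). -/
theorem klka_quarticValue_eq_pairAmplitude (β U μ : ℝ) (K : TrigPolyC4v) (n : ℕ) (k₁ k₂ k₃ : TorusSite 2 L) :
    klQuarticValue L M β U μ K n 0 1 k₁ k₂ k₃ = klPairAmplitude L M β U μ K n (k₁ + k₃) k₂ k₁ := by
  unfold klQuarticValue klPairAmplitude
  have h3 : k₁ + k₃ - k₁ = k₃ := by abel
  have h4 : k₁ + k₃ - k₂ = k₁ - k₂ + k₃ := by abel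
  rw [h3, h4]
  have hperm : (![(((omega0 M, k₁), (0 : Fin 2)), (0 : Fin 2)), ((((omega0 M).rev, k₃), 1), 0),
        ((((omega0 M).rev, k₁ - k₂ + k₃), 1), 1), (((omega0 M, k₂), 0), 1)] : Fin 4 → HubbardFieldIdx L M) =
      (![(((omega0 M, k₁), (0 : Fin 2)), (0 : Fin 2)), (((omega0 M, k₂), 0), 1), ((((omega0 M).rev, k₃), 1), 0),
        ((((omega0 M).rev, k₁ - k₂ + k₃), 1), 1)] : Fin 4 → HubbardFieldIdx L M) ∘
        ⇑(Equiv.swap (1 : Fin 4) 2 * Equiv.swap (2 : Fin 4) 3) := by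
    funext i
    fin_cases i <;> rfl
  rw [hperm, klka_vertexFn_comp_perm, klka_sign_cycle]
  simp

/-- **Value line from a pair-array bound** (the shape of (B1-v2) `PairArrayAt`, which quantifies over EVERY total momentum): if for every
`Q` there is `u` with `‖u‖ ≤ B₁` and `‖𝒞_n(Q;k,k') − u‖ ≤ B₂` for all `k, k'` in the ball, then `‖λ_n^{↑↓}(k₁,k₂,k₃)‖ ≤ B₁ + B₂` for all
ball momenta `k₁, k₂` (and any `k₃`). -/
theorem klka_quarticValue_le_of_pairArray {β U μ : ℝ} {K : TrigPolyC4v} {n : ℕ} {B₁ B₂ : ℝ}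
    (h : ∀ Qm : TorusSite 2 L, ∃ u : ℂ, ‖u‖ ≤ B₁ ∧ ∀ k ∈ klBall L μ K, ∀ k' ∈ klBall L μ K,
      ‖klPairAmplitude L M β U μ K n Qm k k' - u‖ ≤ B₂)
    {k₁ k₂ : TorusSite 2 L} (hk₁ : k₁ ∈ klBall L μ K) (hk₂ : k₂ ∈ klBall L μ K) (k₃ : TorusSite 2 L) :
    ‖klQuarticValue L M β U μ K n 0 1 k₁ k₂ k₃‖ ≤ B₁ + B₂ := by
  rw [klka_quarticValue_eq_pairAmplitude]
  obtain ⟨u, hu, hclose⟩ := h (k₁ + k₃)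
  have h1 := hclose k₂ hk₂ k₁ hk₁
  calc ‖klPairAmplitude L M β U μ K n (k₁ + k₃) k₂ k₁‖
      = ‖(klPairAmplitude L M β U μ K n (k₁ + k₃) k₂ k₁ - u) + u‖ := by rw [sub_add_cancel]
    _ ≤ ‖klPairAmplitude L M β U μ K n (k₁ + k₃) k₂ k₁ - u‖ + ‖u‖ := norm_add_le _ _
    _ ≤ B₂ + B₁ := add_le_add h1 hu
    _ = B₁ + B₂ := add_comm _ _

/-- **`PairArrayAt` gives the `↑↓` value line with the absolute constant `2|U| + C_W U²`** (for ball momenta `k₁, k₂`; `k₃` arbitrary). -/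
theorem klka_quarticValue_le_of_pairArrayAt {P : SplitConsts} {β U μ : ℝ} {K : TrigPolyC4v} {n : ℕ}
    (h : PairArrayAt L M P β U μ K n) {k₁ k₂ : TorusSite 2 L} (hk₁ : k₁ ∈ klBall L μ K) (hk₂ : k₂ ∈ klBall L μ K)
    (k₃ : TorusSite 2 L) :
    ‖klQuarticValue L M β U μ K n 0 1 k₁ k₂ k₃‖ ≤ 2 * |U| + P.C_W * U ^ 2 := by
  refine klka_quarticValue_le_of_pairArray L M (fun Qm => ?_) hk₁ hk₂ k₃
  obtain ⟨u, hu0, hu2, hclose⟩ := h Qm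
  refine ⟨(u : ℂ), ?_, hclose⟩
  rw [Complex.norm_real, Real.norm_eq_abs, abs_of_nonneg hu0]
  exact hu2

end Model

end Summit.HubbardSuperconductivity.HubbardSuperconductivity.Theorems.KLRegimeSplit

end
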